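import Mathlib
import Summits.AtomisticToContinuum.HydrodynamicLimit.Theorems.ImplosionDichotomyDenseExcursionSonicSmoothBranchCkEuler

/-!
# The `T_ν` lemma: the smooth resolvent of the Euler operator `x d/dx + a`, `a > 0`, with NO LOSS OF DERIVATIVES
# (crux `DenseExcursion`, stmt-AtomisticToContinuum-12586, line `sonic-cavity-renewal` v7, stub `stub_analyticPackingImplosion`)

Helper file (`--supports stmt-AtomisticToContinuum-12586`, line lead a2, wave-3 worker D, task (4) `sonicWindow_analytic_bound`,
first brick). At the repulsive sonic point the regular characteristic of the order-`k` problem is, to leading order, the Euler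
equation `x p′ + a p = g` with `a = |ν(kμ)| > 0` (`ν(kμ) = (b(0) − kμ)/κ < 0` for `k ≥ k₀`: the smooth branch is FORCED). Its smooth
solution is `p = T_a g`, `(T_a g)(x) = ∫₀¹ u^{a−1} g(xu) du = x^{−a}∫₀ˣ t^{a−1} g(t) dt`, and differentiating under the integral,
`(T_a g)⁽ʲ⁾(x) = ∫₀¹ u^{a−1+j} g⁽ʲ⁾(xu) du`: EVERY derivative of the solution is controlled by the SAME derivative of the datum with
the GAIN `1/(a + j)` — the quantitative form of "ν < 0 forces the smooth branch with no loss" of the W6 report §4 (contrast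
`euler_smooth_solution`, `…SonicSmoothBranchCkEuler`: `Im ν ≠ 0`, `C^k → C⁰`, loses `k` derivatives). Kernel-checked here:

* `eulerResolvent_smooth_bound` (REGISTERED helper): for `a > 0` and `h` of class `C^∞` on `(−ρ, ρ)` there is `Y` of class
  `C^∞` on `(−ρ, ρ)` with `x Y′ + a Y = h` there and, for every `j` and `x`,
  `|Y⁽ʲ⁾(x)| ≤ sup_{y between 0 and x} |h⁽ʲ⁾(y)| / (a + j)`.

Proof: the chain `I j x = ∫₀¹ s^{a−1+j} h⁽ʲ⁾(xs) ds` satisfies `(I j)′ = I (j+1)` on `(−ρ, ρ)` (differentiation under the integral,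
dominated by `C s^{a−1+j}`, integrable as `a − 1 + j > −1`), so `Y = I 0` is smooth with `Y⁽ʲ⁾ = I j`; the equation is one
integration by parts (`Φ(s) = sᵃ h(xs)`, `Φ(0) = 0` as `a > 0`); the bound is `∫₀¹ s^{a−1+j} ds = 1/(a+j)`. Generic bricks reused
from `…SonicSmoothBranchCkEuler`: `contDiffOn_of_deriv_family`, `hasDerivAt_iteratedDeriv_of_contDiffOn`.
Sources: Coddington–Levinson 1955 Ch. 4 §2; Chen–Shkoller–Vicol arXiv:2605.00808 §1.10. NOT here: the transport
characteristic, the `N_θ` scale, or the perturbation `x ã(x) p`.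
-/

noncomputable section

open Set Filter MeasureTheory intervalIntegral
open scoped Topology ContDiff Interval

namespace Summit.AtomisticToContinuum.HydrodynamicLimit.Theorems.PackingAnalyticImplosion

open Summit.AtomisticToContinuum.HydrodynamicLimit.Theorems.SonicCavityRenewal (contDiffOn_of_deriv_family
  hasDerivAt_iteratedDeriv_of_contDiffOn)

/-- `∫₀¹ M s^{e} ds = M/(e+1)` for `e > −1`. [folklore] -/
theorem integral_const_mul_rpow_unit {e : ℝ} (he : -1 < e) (M : ℝ) :
    ∫ s in (0:ℝ)..1, M * s ^ e = M / (e + 1) := by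
  rw [intervalIntegral.integral_const_mul, integral_rpow (Or.inl he), Real.one_rpow,
    Real.zero_rpow (by linarith : e + 1 ≠ 0)]
  ring

-- adapted from …SonicSmoothBranchCkEuler (`euler_smooth_solution`: complex `ν`, flat remainder); here real `a > 0`, no loss
set_option maxHeartbeats 800000 in -- one declaration: parametric integrals, domination, FTC and the bound in one existential
/-- **THE `T_ν` LEMMA — SMOOTH RESOLVENT OF `x d/dx + a`, `a > 0`, WITHOUT LOSS** (registered helper
`eulerResolvent_smooth_bound` of `stub_analyticPackingImplosion`): for `h` smooth on `(−ρ, ρ)` there is `Y` smooth on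
`(−ρ, ρ)` solving `x Y′ + a Y = h` with `|Y⁽ʲ⁾(x)| ≤ M/(a + j)` whenever `|h⁽ʲ⁾| ≤ M` between `0` and `x`
(`Y = ∫₀¹ s^{a−1} h(xs) ds`). [folklore] -/
theorem eulerResolvent_smooth_bound : ∀ (a ρ : ℝ) (h : ℝ → ℝ), 0 < a → 0 < ρ → ContDiffOn ℝ ∞ h (Set.Ioo (-ρ) ρ) → ∃ Y : ℝ → ℝ, ContDiffOn ℝ ∞ Y (Set.Ioo (-ρ) ρ) ∧ (∀ x ∈ Set.Ioo (-ρ) ρ, x * deriv Y x + a * Y x = h x) ∧ ∀ (j : ℕ) (x : ℝ), x ∈ Set.Ioo (-ρ) ρ → ∀ M : ℝ, (∀ y ∈ Set.uIcc 0 x, |iteratedDeriv j h y| ≤ M) → |iteratedDeriv j Y x| ≤ M / (a + j) := by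
  intro a ρ h ha hρ hh
  set U : Set ℝ := Ioo (-ρ) ρ with hU_def
  have hU : IsOpen U := isOpen_Ioo
  have memU : ∀ {x : ℝ}, x ∈ U ↔ |x| < ρ := fun {x} => by rw [hU_def, mem_Ioo, abs_lt]
  have hxsU : ∀ {x : ℝ}, |x| < ρ → ∀ {s : ℝ}, s ∈ Icc (0 : ℝ) 1 → x * s ∈ U := by
    intro x hx s hs
    refine memU.2 (lt_of_le_of_lt ?_ hx)
    rw [abs_mul, abs_of_nonneg hs.1]
    exact mul_le_of_le_one_right (abs_nonneg x) hs.2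
  -- the derivative chain of `h`
  set D : ℕ → ℝ → ℝ := fun j => iteratedDeriv j h with hD_def
  have hD : ∀ j, ∀ y ∈ U, HasDerivAt (D j) (D (j + 1) y) y := fun j y hy =>
    hasDerivAt_iteratedDeriv_of_contDiffOn hU hh j hy
  have hDcont : ∀ j, ContinuousOn (D j) U := fun j y hy => (hD j y hy).continuousAt.continuousWithinAt
  have DB : ∀ (j : ℕ) (r : ℝ), r < ρ → ∃ B : ℝ, 0 ≤ B ∧ ∀ y ∈ Icc (-r) r, |D j y| ≤ B := by
    intro j r hrρ
    have hsub : Icc (-r) r ⊆ U := fun y hy => memU.2 (lt_of_le_of_lt (abs_le.2 hy) hrρ)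
    obtain ⟨B, hB⟩ := (isCompact_Icc (a := -r) (b := r)).exists_bound_of_continuousOn ((hDcont j).mono hsub)
    exact ⟨max B 0, le_max_right _ _, fun y hy => by
      have := hB y hy; rw [Real.norm_eq_abs] at this; exact this.trans (le_max_left _ _)⟩
  -- the integrals `I j x = ∫₀¹ s^{a−1+j} D j (x s) ds`
  have hexp : ∀ j : ℕ, -1 < a - 1 + (j : ℝ) := fun j => by have : (0:ℝ) ≤ j := Nat.cast_nonneg j; linarith
  set I : ℕ → ℝ → ℝ := fun j x => ∫ s in (0 : ℝ)..1, s ^ (a - 1 + (j : ℝ)) * D j (x * s) with hI_def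
  have hrpow_cont : ∀ e : ℝ, ContinuousOn (fun s : ℝ => s ^ e) (Ioc 0 1) := fun e s hs =>
    (Real.continuousAt_rpow_const s e (Or.inl hs.1.ne')).continuousWithinAt
  have hmeasI : ∀ (j : ℕ) (x : ℝ), |x| < ρ → ∀ (w : ℝ → ℝ), ContinuousOn w (Ioc 0 1) →
      AEStronglyMeasurable (fun s : ℝ => w s * D j (x * s)) (volume.restrict (Ι (0 : ℝ) 1)) := by
    intro j x hx w hw
    rw [uIoc_of_le zero_le_one]
    refine ContinuousOn.aestronglyMeasurable (hw.mul fun s hs => ?_) measurableSet_Ioc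
    exact ((hD j _ (hxsU hx ⟨hs.1.le, hs.2⟩)).continuousAt.comp_continuousWithinAt
      ((continuous_const.mul continuous_id).continuousWithinAt)).mono (fun _ h => h)
  -- pointwise bounds of the integrands near a point
  have hbound : ∀ (j : ℕ) (r : ℝ), 0 ≤ r → r < ρ → ∃ C : ℝ, 0 ≤ C ∧ ∀ x, |x| ≤ r → ∀ s ∈ Ioc (0 : ℝ) 1,
      |D j (x * s)| ≤ C := by
    intro j r hr hrρ
    obtain ⟨B, hB0, hB⟩ := DB j r hrρ
    refine ⟨B, hB0, fun x hx s hs => hB _ ?_⟩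
    have habs : |x * s| ≤ r := by
      rw [abs_mul, abs_of_pos hs.1]
      exact (mul_le_of_le_one_right (abs_nonneg x) hs.2).trans hx
    exact ⟨by linarith [(abs_le.1 habs).1], (abs_le.1 habs).2⟩
  have hintI : ∀ (j : ℕ) (x : ℝ), |x| < ρ →
      IntervalIntegrable (fun s : ℝ => s ^ (a - 1 + (j : ℝ)) * D j (x * s)) volume 0 1 := by
    intro j x hx
    obtain ⟨C, hC0, hC⟩ := hbound j |x| (abs_nonneg x) hx
    refine IntervalIntegrable.mono_fun' ((intervalIntegral.intervalIntegrable_rpow' (hexp j)).const_mul C)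
      (hmeasI j x hx _ (hrpow_cont _)) ?_
    rw [EventuallyLE, ae_restrict_iff' measurableSet_uIoc]
    refine Eventually.of_forall fun s hs => ?_
    rw [uIoc_of_le zero_le_one] at hs
    rw [Real.norm_eq_abs, abs_mul, abs_of_nonneg (Real.rpow_nonneg hs.1.le _), mul_comm]
    exact mul_le_mul_of_nonneg_right (hC x le_rfl s hs) (Real.rpow_nonneg hs.1.le _)
  -- DIFFERENTIATION UNDER THE INTEGRAL: `I j` has derivative `I (j+1)` on `U`
  have hshift : ∀ (j : ℕ) (x s : ℝ), 0 < s → s ^ (a - 1 + (j : ℝ)) * (s * D (j + 1) (x * s)) =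
      s ^ (a - 1 + ((j + 1 : ℕ) : ℝ)) * D (j + 1) (x * s) := by
    intro j x s hs
    rw [← mul_assoc, ← Real.rpow_add_one hs.ne']
    congr 2; push_cast; ring
  have hIder : ∀ j, ∀ x ∈ U, HasDerivAt (I j) (I (j + 1) x) x := by
    intro j x₀ hx₀
    have hx₀' : |x₀| < ρ := memU.1 hx₀
    obtain ⟨r, hr_def⟩ : ∃ r : ℝ, r = (|x₀| + ρ) / 2 := ⟨_, rfl⟩
    have hr0 : 0 ≤ r := by rw [hr_def]; linarith [abs_nonneg x₀]
    have hx₀r : |x₀| < r := by rw [hr_def]; linarith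
    have hrρ : r < ρ := by rw [hr_def]; linarith
    have hS : Ioo (-r) r ∈ 𝓝 x₀ := isOpen_Ioo.mem_nhds (by rw [mem_Ioo, ← abs_lt]; exact hx₀r)
    have hSr : ∀ x ∈ Ioo (-r) r, |x| < r := fun x hx => abs_lt.2 hx
    obtain ⟨C, hC0, hC⟩ := hbound (j + 1) r hr0 hrρ
    have key := intervalIntegral.hasDerivAt_integral_of_dominated_loc_of_deriv_le (μ := volume)
      (a := (0 : ℝ)) (b := 1) (bound := fun _ => C)
      (F := fun (x : ℝ) (s : ℝ) => s ^ (a - 1 + (j : ℝ)) * D j (x * s))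
      (F' := fun (x : ℝ) (s : ℝ) => s ^ (a - 1 + (j : ℝ)) * (s * D (j + 1) (x * s))) hS
      (Filter.eventually_of_mem hS fun x hx => hmeasI j x ((hSr x hx).trans hrρ) _ (hrpow_cont _))
      (hintI j x₀ hx₀') ?_ ?_ intervalIntegrable_const ?_
    · have heq : (∫ s in (0 : ℝ)..1, s ^ (a - 1 + (j : ℝ)) * (s * D (j + 1) (x₀ * s))) = I (j + 1) x₀ :=
        integral_congr_ae (Eventually.of_forall fun s hs =>
          hshift j x₀ s (by rw [uIoc_of_le zero_le_one] at hs; exact hs.1))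
      simpa only [heq] using key.2
    · refine (hmeasI (j + 1) x₀ hx₀' (fun s => s ^ (a - 1 + (j : ℝ)) * s)
        ((hrpow_cont _).mul continuous_id.continuousOn)).congr ?_
      exact Eventually.of_forall fun s => by simp only; ring
    · refine Eventually.of_forall fun s hs x hx => ?_
      rw [uIoc_of_le zero_le_one] at hs
      have he : 0 ≤ a - 1 + (j : ℝ) + 1 := by linarith [hexp j]
      have hs1 : s ^ (a - 1 + (j : ℝ)) * s ≤ 1 := by
        rw [← Real.rpow_add_one hs.1.ne']
        exact Real.rpow_le_one hs.1.le hs.2 he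
      have hs0 : 0 ≤ s ^ (a - 1 + (j : ℝ)) * s := mul_nonneg (Real.rpow_nonneg hs.1.le _) hs.1.le
      rw [Real.norm_eq_abs, ← mul_assoc, abs_mul, abs_of_nonneg hs0]
      calc s ^ (a - 1 + (j : ℝ)) * s * |D (j + 1) (x * s)| ≤ 1 * C :=
            mul_le_mul hs1 (hC x (hSr x hx).le s hs) (abs_nonneg _) (by norm_num)
        _ = C := one_mul C
    · refine Eventually.of_forall fun s hs x hx => ?_
      rw [uIoc_of_le zero_le_one] at hs
      have h0 := (hD j _ (hxsU ((hSr x hx).trans hrρ) ⟨hs.1.le, hs.2⟩)).comp x (hasDerivAt_mul_const s)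
      have h1 : HasDerivAt (fun x : ℝ => D j (x * s)) (s * D (j + 1) (x * s)) x := h0.congr_deriv (by ring)
      exact h1.const_mul _
  have hIsmooth : ContDiffOn ℝ ∞ (I 0) U := contDiffOn_of_deriv_family hU I hIder 0
  -- `Y⁽ʲ⁾ = I j` on `U`
  have hIiter : ∀ j, ∀ x ∈ U, iteratedDeriv j (I 0) x = I j x := by
    intro j
    induction j with
    | zero => intro x _; simp
    | succ j ih =>
      intro x hx
      rw [iteratedDeriv_succ]
      have hev : iteratedDeriv j (I 0) =ᶠ[𝓝 x] I j :=
        Filter.eventuallyEq_of_mem (hU.mem_nhds hx) fun y hy => ih y hy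
      rw [hev.deriv_eq]
      exact (hIder j x hx).deriv
  -- INTEGRATION BY PARTS: `x I 1 x + a I 0 x = h x`
  have hIBP : ∀ x ∈ U, x * I 1 x + a * I 0 x = h x := by
    intro x hx
    have hx' : |x| < ρ := memU.1 hx
    set Φ : ℝ → ℝ := fun s => s ^ a * D 0 (x * s) with hΦ
    set Φ' : ℝ → ℝ := fun s => a * (s ^ (a - 1 + ((0 : ℕ) : ℝ)) * D 0 (x * s)) +
      x * (s ^ (a - 1 + ((1 : ℕ) : ℝ)) * D 1 (x * s)) with hΦ'
    have e0 : a - 1 + ((0 : ℕ) : ℝ) = a - 1 := by push_cast; ring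
    have e1 : a - 1 + ((1 : ℕ) : ℝ) = a := by push_cast; ring
    have hΦder : ∀ s ∈ Ioo (0 : ℝ) 1, HasDerivAt Φ (Φ' s) s := by
      intro s hs
      have h1 : HasDerivAt (fun s : ℝ => s ^ a) (a * s ^ (a - 1)) s := Real.hasDerivAt_rpow_const (Or.inl hs.1.ne')
      have h20 := (hD 0 _ (hxsU hx' ⟨hs.1.le, hs.2.le⟩)).comp s (hasDerivAt_const_mul x)
      have h2 : HasDerivAt (fun s : ℝ => D 0 (x * s)) (x * D 1 (x * s)) s := h20.congr_deriv (by ring)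
      refine (h1.mul h2).congr_deriv ?_
      simp only [hΦ', e0, e1]
      have : s ^ a = s ^ (a - 1) * s := by rw [← Real.rpow_add_one hs.1.ne']; ring_nf
      rw [this]; ring
    have hΦ0 : Φ 0 = 0 := by simp only [hΦ]; rw [Real.zero_rpow ha.ne', zero_mul]
    have hΦ1 : Φ 1 = h x := by simp [hΦ, hD_def]
    have hΦcont : ContinuousOn Φ (Icc 0 1) := by
      intro s hs
      refine ContinuousAt.continuousWithinAt ?_
      exact (Real.continuousAt_rpow_const s a (Or.inr ha.le)).mul
        ((hD 0 _ (hxsU hx' hs)).continuousAt.comp (continuous_const.mul continuous_id).continuousAt)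
    have hint0 := hintI 0 x hx'
    have hint1 := hintI 1 x hx'
    have hFTC := intervalIntegral.integral_eq_sub_of_hasDerivAt_of_le zero_le_one hΦcont hΦder
      ((hint0.const_mul a).add (hint1.const_mul x))
    have hsplit : (∫ s in (0 : ℝ)..1, Φ' s) = a * I 0 x + x * I 1 x := by
      simp only [hΦ', hI_def]
      rw [intervalIntegral.integral_add (hint0.const_mul _) (hint1.const_mul _),
        intervalIntegral.integral_const_mul, intervalIntegral.integral_const_mul]
    rw [hΦ1, hΦ0, sub_zero, hsplit] at hFTC
    linarith
  -- THE BOUND `|I j x| ≤ M/(a+j)`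
  have hIbound : ∀ (j : ℕ) (x : ℝ), x ∈ U → ∀ M : ℝ, (∀ y ∈ uIcc 0 x, |D j y| ≤ M) → |I j x| ≤ M / (a + j) := by
    intro j x hx M hM
    have hx' : |x| < ρ := memU.1 hx
    have hxs : ∀ s ∈ Ioc (0:ℝ) 1, x * s ∈ uIcc 0 x := by
      intro s hs
      rcases le_or_gt 0 x with h0 | h0
      · rw [uIcc_of_le h0]
        exact ⟨mul_nonneg h0 hs.1.le, mul_le_of_le_one_right h0 hs.2⟩
      · rw [uIcc_of_ge h0.le]
        exact ⟨by nlinarith [hs.1, hs.2], by nlinarith [hs.1]⟩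
    have hle : |I j x| ≤ ∫ s in (0:ℝ)..1, M * s ^ (a - 1 + (j : ℝ)) := by
      have h1 := intervalIntegral.norm_integral_le_of_norm_le (μ := volume) zero_le_one
        (f := fun s : ℝ => s ^ (a - 1 + (j : ℝ)) * D j (x * s)) (g := fun s => M * s ^ (a - 1 + (j : ℝ)))
        (Eventually.of_forall fun s hs => by
          rw [Real.norm_eq_abs, abs_mul, abs_of_nonneg (Real.rpow_nonneg hs.1.le _), mul_comm]
          exact mul_le_mul_of_nonneg_right (hM _ (hxs s hs)) (Real.rpow_nonneg hs.1.le _))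
        ((intervalIntegral.intervalIntegrable_rpow' (hexp j)).const_mul M)
      rw [Real.norm_eq_abs] at h1
      exact h1
    rw [integral_const_mul_rpow_unit (hexp j) M, show a - 1 + (j : ℝ) + 1 = a + j by ring] at hle
    exact hle
  -- assemble
  refine ⟨I 0, hIsmooth, fun x hx => ?_, fun j x hx M hM => ?_⟩
  · rw [(hIder 0 x hx).deriv]
    exact hIBP x hx
  · rw [hIiter j x hx]
    exact hIbound j x hx M hM

end Summit.AtomisticToContinuum.HydrodynamicLimit.Theorems.PackingAnalyticImplosion

end
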